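import Literature.Probability.Percolation.AltFourArmLowerBound
import HarnessLib

/-!
# Alternating four-arm separation below `L(p)` (Nolin 2008, Thm. 11 for `j = 4`, `σ = BWBW`):
# the one named leaf of Werner's one-arm stability, and the assembly

Topic `Literature/Probability/Percolation`; family `crit-perc`. Fact decomposition (librarian,
`fact-decompose`, human ruling 2026-08-16) of the budget-capped named fact
`Literature.Probability.Percolation.Werner2009_oneArm_nearCritical` (`WernerCorrelationLength.lean`;
W. Werner, *Lectures on two-dimensional critical percolation*, IAS/Park City Math. Ser. 16 (2009),
Lecture 6, §5: `P_p(0 ↔ ∂Λ_n) ≍ P_{1/2}(0 ↔ ∂Λ_n)` for `n ≤ L(p)`; originally Kesten 1987, Thm. 1).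

## The printed proof and what the tree already proves of it

Werner's §5 derives the stability of the one-arm probability from the differential inequality
`|d/dp log P_p(0 ↔ ∂Λ_n)| ≤ c n² π̂_p(n)` and Lemma 6.2, whose inputs are (§3) the a priori bounds
on arm probabilities, (§4, Prop. 6.1) the ARM-SEPARATION theorem below `L(p)` ("the arms can be
required to land on prescribed parts of the boundary and to be well separated, at constant
cost"; Kesten 1987, Lemmas 4–6; Nolin 2008, Thm. 11) and its corollaries quasi-multiplicativity
and extendability (Cor. 6.1–6.2). The tree PROVES every step of this for the alternating four-arm
probability `π̂^alt = altFourArmProbAt` EXCEPT the separation theorem itself: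
`Werner2009_oneArm_nearCritical_of_altSeparation'` (`AltFourArmLowerBound.lean`, with
`WernerOneArmStabilityFromAltSeparation.lean`, `OneArmLogDerivFromAltSeparation.lean`,
`AltFourArmGlue.lean`; the a priori lower bound `altFourArm_lowerBound` is a theorem) takes as
its ONLY hypothesis the displayed statement vendored below. The same hypothesis alone also gives
the named facts `Werner2009_oneArm_logDeriv` (`WernerPivotalEstimates.lean`; Werner's display (C))
and `Nolin2008_thm27_oneArm` (`NearCriticalScaling.lean`; Nolin 2008, Thm. 27 for `j = 1`):
`Werner2009_oneArm_logDeriv_of_altSeparation'`, `Nolin2008_thm27_oneArm_of_altSeparation`.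

## Contents

* `Nolin2008_altFourArm_separation_nearCritical` — NAMED FACT (the child): Nolin 2008, Thm. 11
  [arXiv 0711.4948: Thm. 10] for `j = 4`, `σ = BWBW`, lower bound, uniformly in `p̂` near `1/2`
  and `n ≤ N` below the characteristic length; Werner 2009, Prop. 6.1; Kesten 1987, Lemma 6 with
  Lemmas 4–5. Verbatim the hypothesis `hsep` consumed by the 19 proof files of the tree that
  run Kesten's near-critical calculus from separation (`…FromAltSeparation.lean`).
* `Werner2009_oneArm_nearCritical_holds_of` — PROVED assembly: the child implies the parent.
* `Werner2009_oneArm_logDeriv_holds_of`, `Nolin2008_thm27_oneArm_holds_of` — PROVED: the same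
  child discharges these two further named facts.

The critical (`p = 1/2`) two-arm instance of the same theorem, `Nolin2008_twoArm_separation`
(`ArmSeparation.lean`), is meanwhile a THEOREM of the tree (`Nolin2008_twoArm_separation_holds`,
`ArmSeparationFinalProofs.lean`, Nolin §4.4 on the doubling ladder); the external half of the
four-arm near-critical case is proved at every `p` modulo RSW inputs
(`exists_real_altFourArm_le_mul_extFourArmQ_at`, `ArmSeparationOutSchemeFour.lean`), so the child
below is the natural next target of that development, and its discharge
`Nolin2008_altFourArm_separation_nearCritical_holds` closes three named facts at once.

## References

* P. Nolin, Near-critical percolation in two dimensions, *Electron. J. Probab.* 13 (2008)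
  1562–1623, §4.3 Thm. 11 and §4.4 (proof), Rem. 9 (arXiv 0711.4948: Thm. 10, Rem. 8) [Nolin2008].
* W. Werner, *Lectures on two-dimensional critical percolation*, IAS/Park City Math. Ser. 16
  (2009), Lecture 6, §4 Prop. 6.1, §5 [WernerPCMI2009].
* H. Kesten, Scaling relations for 2D-percolation, *Comm. Math. Phys.* 109 (1987) 109–156,
  Lemmas 4–6 [KestenScalingCMP1987].
-/

noncomputable section

open Set MeasureTheory
open scoped unitInterval

namespace Literature.Probability.Percolation

open LatticeModels

/-! ### The child: alternating four-arm separation below Werner's `L(p, ε)` -/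

/-- **Arm separation for four alternating arms, near criticality** (Nolin 2008, Thm. 11 [arXiv
0711.4948: Thm. 10]: "Fix an integer `j ≥ 1`, some color sequence `σ` and `η₀, η'₀ ∈ (0,1)`. Then
`P̂(Ã̃^{η,I/η',I'}_{j,σ}(n, N)) ≍ P̂(A_{j,σ}(n, N))` uniformly in all landing sequences `I/I'` of
size `η/η'`, with `η ≥ η₀` and `η' ≥ η'₀`, `p`, `P̂` between `P_p` and `P_{1-p}`, `n ≤ N ≤ L(p)`",
specialised to `j = 4`, `σ = BWBW`, the lower bound `≳`; Werner 2009, Lecture 6, Prop. 6.1;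
Kesten 1987, Lemma 6 with Lemmas 4–5). In Lean, in `∀∃` form: for every small enough `ε` there
are a threshold `n₀`, a right neighbourhood `[1/2, 1/2 + δ)` of `1/2` and `c > 0` such that
`c · P_t(altFourArm n N) ≤ P_t(sepFourArm n N)` for `n₀ ≤ n`, `2n ≤ N`, and `N ≤ L(t, ε)` when
`t > 1/2` (no restriction at `t = 1/2`, where `L = ∞`). Here `altFourArm n N` (`AltFourArm.lean`)
is the alternating four-arm event across `Λ_N ∖ Λ_n` (`altFourArmProbAt t n N` its
`P_t`-probability, Werner's `π̂_p(n, N)`), `sepFourArm n N` (`ArmSeparationFourArm.lean`) the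
well-separated alternating event with fenced arms landing on the middle halves of the sides
`0, 1, 3, 4` of the hexagons (Nolin's `Ã̃` with `η = η' = 1/64`, relaxed as in `sepOpenArm`, so
only `≳` is recorded), and `L(t, ε) = charLengthW ε t` is WERNER's correlation length
(`WernerCorrelationLength.lean`), which lies below Nolin's `L_{ε'}(t)` for a suitable `ε'`
(`charLengthW_le_charLength_of_gt`, `CharLengthWRSW.lean`); the parameters `t ∈ [1/2, 1/2 + δ)`
are Nolin's `P̂ = P_p`, `p ≥ 1/2` (the closed arms at `t` being open arms at `1 - t`). Hexagonal
annuli replace Nolin's rhombi and `2n ≤ N` is the first reduction step of §4.4, as for the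
critical two-arm instance `Nolin2008_twoArm_separation` (a theorem of the tree). At most weaker
than printed. This is verbatim the hypothesis `hsep` of
`Werner2009_oneArm_nearCritical_of_altSeparation` and of the other `…FromAltSeparation` reductions.
[cite: Nolin2008, §4.3 Thm. 11, j = 4, σ = BWBW, lower bound (arXiv 0711.4948: Thm. 10)]
[cite: WernerPCMI2009, Lecture 6, §4 Prop. 6.1]
[cite: KestenScalingCMP1987, Lemma 6 (with Lemmas 4–5)] -/
def Nolin2008_altFourArm_separation_nearCritical : Prop :=
  ∃ ε₁ > (0 : ℝ), ∀ ⦃ε : ℝ⦄, 0 < ε → ε < ε₁ →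
    ∃ n₀ : ℕ, ∃ δ > (0 : ℝ), ∃ c > (0 : ℝ),
      ∀ t : unitInterval, 1 / 2 ≤ (t : ℝ) → (t : ℝ) < 1 / 2 + δ →
        ∀ n N : ℕ, n₀ ≤ n → 2 * n ≤ N → (1 / 2 < (t : ℝ) → N ≤ charLengthW ε t) →
          c * altFourArmProbAt t n N ≤ (triSitePercolation t).real (sepFourArm n N)

/-! ### Assembly: the child gives the parent (and two further named facts) -/

/-- **Assembly of the split of `Werner2009_oneArm_nearCritical`**: alternating four-arm separation
below `L(p)` (`Nolin2008_altFourArm_separation_nearCritical`) implies Werner's one-arm stability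
`P_p(0 ↔ ∂Λ_n) ≍ P_{1/2}(0 ↔ ∂Λ_n)`, `n ≤ L(p)` — by the tree's
`Werner2009_oneArm_nearCritical_of_altSeparation'` (`AltFourArmLowerBound.lean`: Werner's §5 run
with the well-separated kernel, the a priori lower bound `altFourArm_lowerBound` being proved).
[cite: WernerPCMI2009, Lecture 6, §5 ("Using differential inequalities for the one-arm event") with Prop. 6.1] -/
theorem Werner2009_oneArm_nearCritical_holds_of :
    Nolin2008_altFourArm_separation_nearCritical → Werner2009_oneArm_nearCritical :=
  fun hsep => Werner2009_oneArm_nearCritical_of_altSeparation' hsep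

/-- **The same child discharges Werner's display (C)** `Σ_x P_t(x pivotal for {0 ↔ ∂Λ_N}) ≤
C N² π̂_t(N) P_t(0 ↔ ∂Λ_N)` below `L(t)` (the named fact `Werner2009_oneArm_logDeriv`,
`WernerPivotalEstimates.lean`), by `Werner2009_oneArm_logDeriv_of_altSeparation'`.
[cite: WernerPCMI2009, Lecture 6, §5 (display: |d/dp log P_p(0 ↔ ∂Λ_n)| ≤ c n² π̂_p(n)) with Prop. 6.1] -/
theorem Werner2009_oneArm_logDeriv_holds_of :
    Nolin2008_altFourArm_separation_nearCritical → Werner2009_oneArm_logDeriv :=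
  fun hsep => Werner2009_oneArm_logDeriv_of_altSeparation' hsep

/-- **The same child discharges Nolin's Thm. 27 for one arm** (`Nolin2008_thm27_oneArm`,
`NearCriticalScaling.lean`: `P_p(0 ↔ ∂S_n) ≍ P_{1/2}(0 ↔ ∂S_n)` uniformly for `n ≤ L_ε(p)`), by
`Nolin2008_thm27_oneArm_of_altSeparation` (quasi-multiplicativity and the pivotal lower bound from
separation, `AltFourArmGlue.lean`, `WernerOneArmStabilityFromAltSeparation.lean`).
[cite: Nolin2008, §6.2 Thm. 27, j = 1 (arXiv 0711.4948: Thm. 26), with Thm. 11] -/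
theorem Nolin2008_thm27_oneArm_holds_of :
    Nolin2008_altFourArm_separation_nearCritical → Nolin2008_thm27_oneArm :=
  fun hsep => Nolin2008_thm27_oneArm_of_altSeparation hsep

end Literature.Probability.Percolation

end
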